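import Literature.Geometry.Kaehler.AnalyticSetProjectionCover
import Literature.Geometry.Kaehler.AnalyticSetProjectionProofs
import Literature.Geometry.Kaehler.AnalyticSetLipschitzGraph
import Literature.Geometry.Kaehler.UniformTransversePlane
import Literature.Geometry.GeometricMeasureTheory.HausdorffLipschitzCover
import Mathlib.MeasureTheory.Constructions.Polish.Basic
import Mathlib.MeasureTheory.Constructions.BorelSpace.Complex
import HarnessLib

/-!
# Lelong's theorem, local model form: analytic sets of dimension `≤ p` have locally finite
`𝓗^{2p}`-measure

The core of the proof of the named fact
`Literature.Geometry.Kaehler.Lelong1957_hausdorffMeasure_inter_lt_top`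
(`Literature/Geometry/Kaehler/HolomorphicChainFacts.lean`; [Chirka1989, §14.1 Thm.], Lelong 1957):
for a subset `A` analytic on an open set `Ω` of a finite-dimensional complex normed space `E`
and a point `a ∈ Ω` near which `dim A ≤ p` (every regular point of `A` near `a` has codimension
`q` with `dim E ≤ q + p`), some neighbourhood `U` of `a` has `μH[2p] (A ∩ U) < ∞`
(`hausdorffMeasure_inter_lt_top_of_dim_le`).

The printed proofs ([Chirka1989, §14.1], [Harvey1977, Lemma 1.3]) bound the volume of the
manifold `reg A` through Wirtinger's theorem and the area formula, neither of which is available.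
We argue instead by induction on `p` with a covering estimate:

* after a generic linear change of coordinates all coordinate projections `ℓ_I : E → ℂᵖ`,
  `#I = p`, are proper on `A` near `a` ([Chirka1989, §3.4 Lemma 2],
  `Literature.Geometry.Kaehler.SCV.exists_continuousLinearEquiv_forall_isCompact_inter_preimage`),
  so each carries a local analytic cover ([Chirka1989, §3.7],
  `Literature.Geometry.Kaehler.SCV.exists_projection_cover`): on a neighbourhood `P_I` the fibres
  of `ℓ_I` on `A` have `≤ K_I` points, and off an analytic `B_I ⊆ A ∩ P_I` of dimension `< p`
  every point of `A ∩ P_I` is regular of top dimension;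
* every complex `p`-plane is `C`-transverse to some `ℓ_I` with one constant `C`
  (`Literature.Geometry.Kaehler.exists_uniform_bound_of_forall_exists_ker_inf_eq_bot`), so the
  top-dimensional regular part of `A` near `a` is covered by countably many graphs of
  `(C + 1)`-Lipschitz sections of the `ℓ_I`
  (`Literature.Geometry.Kaehler.SCV.exists_countable_lipschitz_graph_cover`), and the counting
  lemma `Literature.Geometry.GeometricMeasureTheory.hausdorffMeasure_iUnion_le_of_lipschitzOnWith_of_fibre`
  bounds its `μH[2p]`-measure by `Σ_I (C + 1)^{2p} K_I μH[2p] (ℓ_I (U)) < ∞`;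
* the rest of `A` near `a` lies in `B_I`, which by the induction hypothesis has locally finite
  `μH[2p-2]`-measure, hence is `μH[2p]`-null.

Theorems only; the statement is in the model-space language
(`Literature.Analysis.Complex.SCV.IsZeroSetAt`, `Literature.Geometry.Kaehler.SCV.IsRegPt`) for
spaces `E : Type` (the manifold form, in every universe, is derived in
`Literature/Geometry/Kaehler/HolomorphicChainFactsLelongProofs.lean` by a linear chart).

## References

* E. M. Chirka, *Complex Analytic Sets*, Kluwer (1989), §3.4 Lemma 2, §3.7 Thm., §14.1 Thm.
  (Lelong's theorem) [Chirka1989].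
* R. Harvey, *Holomorphic chains and their boundaries*, PSPUM XXX.1 (1977), Lemma 1.3
  [Harvey1977].
-/

open scoped Topology NNReal ENNReal Manifold
open Set Filter Metric MeasureTheory Function

namespace Literature.Geometry.Kaehler
namespace SCV

open Literature.Analysis.Complex.SCV (IsZeroSetAt)
open Literature.Geometry.GeometricMeasureTheory

/-! ### Uniform transversality in a normed space -/

section Transverse

variable {E : Type*} [NormedAddCommGroup E] [NormedSpace ℂ E] [FiniteDimensional ℂ E]
  {F : Type*} [NormedAddCommGroup F] [NormedSpace ℂ F]

/-- `exists_uniform_bound_of_forall_exists_ker_inf_eq_bot` in a finite-dimensional complex normed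
space (transfer through a linear homeomorphism with a Euclidean space). [folklore] -/
theorem exists_uniform_bound_normed {κ : Type*} [Fintype κ] (ℓ : κ → E →L[ℂ] F) {p : ℕ}
    (h : ∀ T : Submodule ℂ E, Module.finrank ℂ T = p →
      ∃ k, LinearMap.ker (ℓ k : E →ₗ[ℂ] F) ⊓ T = ⊥) :
    ∃ C : ℝ≥0, ∀ T : Submodule ℂ E, Module.finrank ℂ T = p →
      ∃ k, ∀ v ∈ T, ‖v‖ ≤ C * ‖ℓ k v‖ := by
  set n := Module.finrank ℂ E with hn
  have hdim : Module.finrank ℂ E = Module.finrank ℂ (EuclideanSpace ℂ (Fin n)) := by simp [hn]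
  set Φ : E ≃L[ℂ] EuclideanSpace ℂ (Fin n) := ContinuousLinearEquiv.ofFinrankEq hdim with hΦ
  set ℓ' : κ → EuclideanSpace ℂ (Fin n) →L[ℂ] F :=
    fun k => (ℓ k).comp (Φ.symm : EuclideanSpace ℂ (Fin n) →L[ℂ] E) with hℓ'
  have h' : ∀ T' : Submodule ℂ (EuclideanSpace ℂ (Fin n)), Module.finrank ℂ T' = p →
      ∃ k, LinearMap.ker (ℓ' k : EuclideanSpace ℂ (Fin n) →ₗ[ℂ] F) ⊓ T' = ⊥ := by
    intro T' hT'
    set T : Submodule ℂ E := T'.map (Φ.symm.toLinearEquiv : EuclideanSpace ℂ (Fin n) →ₗ[ℂ] E)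
      with hT
    have hTp : Module.finrank ℂ T = p := by
      rw [hT, LinearEquiv.finrank_map_eq]; exact hT'
    obtain ⟨k, hk⟩ := h T hTp
    refine ⟨k, ?_⟩
    rw [Submodule.eq_bot_iff] at hk ⊢
    intro v' hv'
    obtain ⟨hv'k, hv'T⟩ := Submodule.mem_inf.1 hv'
    have hmem : Φ.symm v' ∈ LinearMap.ker (ℓ k : E →ₗ[ℂ] F) ⊓ T := by
      refine Submodule.mem_inf.2 ⟨?_, ?_⟩
      · rw [LinearMap.mem_ker] at hv'k ⊢
        simpa [hℓ'] using hv'k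
      · exact Submodule.mem_map_of_mem hv'T
    have h0 := hk _ hmem
    simpa using congrArg Φ h0
  obtain ⟨C', hC'pos, hC'⟩ := exists_uniform_bound_of_forall_exists_ker_inf_eq_bot ℓ' h'
  refine ⟨‖(Φ.symm : EuclideanSpace ℂ (Fin n) →L[ℂ] E)‖₊ * Real.toNNReal C', fun T hT => ?_⟩
  set T' : Submodule ℂ (EuclideanSpace ℂ (Fin n)) :=
    T.map (Φ.toLinearEquiv : E →ₗ[ℂ] EuclideanSpace ℂ (Fin n)) with hT'
  have hT'p : Module.finrank ℂ T' = p := by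
    rw [hT', LinearEquiv.finrank_map_eq]; exact hT
  obtain ⟨k, hk⟩ := hC' T' hT'p
  refine ⟨k, fun v hv => ?_⟩
  have hv' : Φ v ∈ T' := Submodule.mem_map_of_mem hv
  have h1 := hk (Φ v) hv'
  have h2 : ℓ' k (Φ v) = ℓ k v := by simp [hℓ']
  rw [h2] at h1
  calc ‖v‖ = ‖(Φ.symm : EuclideanSpace ℂ (Fin n) →L[ℂ] E) (Φ v)‖ := by simp
    _ ≤ ‖(Φ.symm : EuclideanSpace ℂ (Fin n) →L[ℂ] E)‖ * ‖Φ v‖ :=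
        ContinuousLinearMap.le_opNorm _ _
    _ ≤ ‖(Φ.symm : EuclideanSpace ℂ (Fin n) →L[ℂ] E)‖ * (C' * ‖ℓ k v‖) := by
        gcongr
    _ = (‖(Φ.symm : EuclideanSpace ℂ (Fin n) →L[ℂ] E)‖₊ * Real.toNNReal C' : ℝ≥0) * ‖ℓ k v‖ := by
        rw [NNReal.coe_mul, coe_nnnorm, Real.coe_toNNReal _ hC'pos.le]; ring

end Transverse

/-! ### Elementary measure-theoretic steps -/

section Measure

variable {E : Type*} [NormedAddCommGroup E] [NormedSpace ℂ E] [FiniteDimensional ℂ E]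
  [MeasurableSpace E] [BorelSpace E]

omit [FiniteDimensional ℂ E] [MeasurableSpace E] [BorelSpace E] in
/-- Off `A`, a neighbourhood misses `A` (the local equations do not vanish at the point), so the
measure there is zero. [folklore] -/
theorem exists_nhds_inter_eq_empty {A : Set E} {a : E} (hA : IsZeroSetAt A a) (haA : a ∉ A) :
    ∃ U ∈ 𝓝 a, A ∩ U = ∅ := by
  obtain ⟨U₀, hU₀, haU₀, N, g, hg, hAU₀⟩ := hA
  have hga : g a ≠ 0 := fun h0 => haA (hAU₀.symm.subset ⟨haU₀, h0⟩).1
  refine ⟨U₀ ∩ g ⁻¹' {0}ᶜ, (hg.continuousOn.isOpen_inter_preimage hU₀ isOpen_compl_singleton).mem_nhds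
    ⟨haU₀, hga⟩, ?_⟩
  ext z
  simp only [mem_inter_iff, mem_preimage, mem_compl_iff, mem_singleton_iff, mem_empty_iff_false,
    iff_false, not_and, not_not]
  intro hzA hzU
  exact (hAU₀.subset ⟨hzA, hzU⟩).2

/-- In the top dimension and above nothing is to be proved: if `dim_ℂ E ≤ p` then `μH[2p]` is
finite on bounded sets (`μH[2 dim E]` is an additive Haar measure, and `μH[d] = 0` for
`d > 2 dim E` on sets of finite `μH[2 dim E]`-measure). [folklore] -/
theorem hausdorffMeasure_lt_top_of_finrank_le {p : ℕ} (hp : Module.finrank ℂ E ≤ p) {s : Set E}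
    (hs : Bornology.IsBounded s) : μH[(2 * p : ℕ)] s < ⊤ := by
  have hE : Module.finrank ℝ E = 2 * Module.finrank ℂ E := finrank_real_of_complex E
  have htop : μH[(2 * Module.finrank ℂ E : ℕ)] s < ⊤ := by
    rw [← hE]
    exact hs.measure_lt_top
  rcases hp.eq_or_lt with h | h
  · rw [← h]; exact htop
  · have hlt : ((2 * Module.finrank ℂ E : ℕ) : ℝ) < (2 * p : ℕ) := Nat.cast_lt.2 (by omega)
    rw [hausdorffMeasure_eq_zero_of_lt_of_lt_top hlt htop]
    exact ENNReal.zero_lt_top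

omit [NormedSpace ℂ E] [FiniteDimensional ℂ E] in
/-- A finite set has finite `μH[0]`-measure. [folklore] -/
theorem hausdorffMeasure_zero_lt_top_of_finite {s : Set E} (hs : s.Finite) :
    μH[(2 * 0 : ℕ)] s < ⊤ := by
  classical
  have h0 : ((2 * 0 : ℕ) : ℝ) = 0 := by norm_num
  have hs' : s = ⋃ x ∈ hs.toFinset, ({x} : Set E) := by
    ext z
    simp
  rw [h0, hs']
  calc μH[0] (⋃ x ∈ hs.toFinset, ({x} : Set E)) ≤ ∑ x ∈ hs.toFinset, μH[0] ({x} : Set E) :=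
        measure_biUnion_finset_le _ _
    _ < ⊤ := by
        refine ENNReal.sum_lt_top.2 fun x _ => ?_
        rw [Measure.hausdorffMeasure_zero_singleton]
        exact ENNReal.one_lt_top

omit [FiniteDimensional ℂ E] in
/-- An analytic set is relatively closed in `Ω`, hence `A ∩ U` is Borel for open `U ⊆ Ω`.
[folklore] -/
theorem measurableSet_inter_of_isZeroSetAt {A Ω U : Set E} (hA : ∀ x ∈ Ω, IsZeroSetAt A x)
    (hU : IsOpen U) (hUΩ : U ⊆ Ω) : MeasurableSet (A ∩ U) := by
  have heq : A ∩ U = closure A ∩ U := by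
    ext z
    constructor
    · rintro ⟨hzA, hzU⟩; exact ⟨subset_closure hzA, hzU⟩
    · rintro ⟨hzcl, hzU⟩; exact ⟨(hA z (hUΩ hzU)).mem_of_mem_closure hzcl, hzU⟩
  rw [heq]
  exact isClosed_closure.measurableSet.inter hU.measurableSet

end Measure

/-! ### The theorem -/

section Main

/-- **Lelong's theorem, local model form** ([Chirka1989, §14.1 Thm.]; Lelong 1957): if `A` is
analytic on the open set `Ω` of a finite-dimensional complex normed space `E`, `a ∈ Ω`, and near
`a` every regular point of `A` has codimension `q` with `dim E ≤ q + p` (`dim_a A ≤ p`), then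
`μH[2p] (A ∩ U) < ∞` for some neighbourhood `U` of `a`. Proof by induction on `p` through local
analytic covers for all coordinate projections, Lipschitz graph pieces of bounded multiplicity,
and the induction hypothesis for the part over the critical values (module docstring); the
printed proof via Wirtinger's inequality is replaced by this covering argument.
[cite: Chirka1989, §14.1 Thm., p. 173] -/
theorem hausdorffMeasure_inter_lt_top_of_dim_le (p : ℕ) :
    ∀ {E : Type} [NormedAddCommGroup E] [NormedSpace ℂ E] [FiniteDimensional ℂ E]
      [MeasurableSpace E] [BorelSpace E] {Ω A : Set E} {a : E}, IsOpen Ω → A ⊆ Ω →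
      (∀ x ∈ Ω, IsZeroSetAt A x) → a ∈ Ω →
      (∃ W ∈ 𝓝 a, ∀ x ∈ W ∩ regLocus A, ∀ q, IsRegPt A q x → Module.finrank ℂ E ≤ q + p) →
      ∃ U ∈ 𝓝 a, μH[(2 * p : ℕ)] (A ∩ U) < ⊤ := by
  induction p with
  | zero =>
    intro E _ _ _ _ _ Ω A a hΩ hAΩ hA haΩ hW
    classical
    by_cases haA : a ∈ A
    swap
    · obtain ⟨U, hU, hAU⟩ := exists_nhds_inter_eq_empty (hA a haΩ) haA
      exact ⟨U, hU, by rw [hAU, measure_empty]; exact ENNReal.zero_lt_top⟩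
    -- `dim_a A ≤ 0`: `a` is isolated in `A` (proper projection to `ℂ⁰`), so `A` is finite near `a`
    have hA' : IsAnalyticSetOn 𝓘(ℂ, E) A Ω := fun x hx =>
      Literature.Analysis.Complex.SCV.isZeroSetAt_iff_isAnalyticSetAt.1 (hA x hx)
    have hW' : ∃ W ∈ 𝓝 a, ∀ x ∈ W ∩ regularLocus 𝓘(ℂ, E) A, ∀ q,
        IsRegularPointOfCodim 𝓘(ℂ, E) A q x → Module.finrank ℂ E ≤ q + 0 := by
      obtain ⟨W, hW, h⟩ := hW
      refine ⟨W, hW, fun x hx q hq => ?_⟩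
      rw [regularLocus_eq_regLocus] at hx
      exact h x hx q (isRegularPointOfCodim_iff_isRegPt.1 hq)
    set mproj : Unit → E →L[ℂ] (Fin 0 → ℂ) := fun _ => 0 with hmproj
    have hmsurj : ∀ i, Function.Surjective (mproj i) := fun _ t => ⟨0, Subsingleton.elim _ _⟩
    obtain ⟨l, hl⟩ := (exists_continuousLinearEquiv_forall_isCompact_inter_preimage_holds E)
      hmsurj hΩ hAΩ hA' haA hW'
    obtain ⟨V₁, hV₁o, haV₁, V', -, hV₁V', hcpt⟩ := hl ()
    have hK : IsCompact (A ∩ V₁) := by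
      have h := hcpt V' Subset.rfl (Set.toFinite V').isCompact
      have heq : A ∩ V₁ ∩ ((mproj ()).comp (l : E →L[ℂ] E)) ⁻¹' V' = A ∩ V₁ :=
        inter_eq_left.2 fun z hz => hV₁V' hz.2
      rwa [heq] at h
    have hfin : (A ∩ V₁).Finite := by
      refine finite_of_isCompact_of_isZeroSetAt hK fun z hz => ?_
      exact (hA z (hAΩ hz.1)).congr hV₁o hz.2 (by rw [inter_assoc, inter_self])
    exact ⟨V₁, hV₁o.mem_nhds haV₁, hausdorffMeasure_zero_lt_top_of_finite hfin⟩
  | succ p ih =>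
    intro E _ _ _ _ _ Ω A a hΩ hAΩ hA haΩ hW
    classical
    by_cases haA : a ∈ A
    swap
    · obtain ⟨U, hU, hAU⟩ := exists_nhds_inter_eq_empty (hA a haΩ) haA
      exact ⟨U, hU, by rw [hAU, measure_empty]; exact ENNReal.zero_lt_top⟩
    set n := Module.finrank ℂ E with hn
    -- top dimension and above
    by_cases hnp : n ≤ p + 1
    · refine ⟨ball a 1, ball_mem_nhds a one_pos, ?_⟩
      exact lt_of_le_of_lt (measure_mono inter_subset_right)
        (hausdorffMeasure_lt_top_of_finrank_le hnp isBounded_ball)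
    push Not at hnp
    obtain ⟨m, hm⟩ : ∃ m, n = (m + 1) + (p + 1) := ⟨n - (p + 1) - 1, by omega⟩
    -- coordinate projections, made proper near `a` by a generic linear change of coordinates
    set b : Module.Basis (Fin n) ℂ E := Module.finBasisOfFinrankEq ℂ E hn.symm with hb
    haveI : Nonempty (Fin (p + 1) ↪ Fin n) :=
      Function.Embedding.nonempty_iff_card_le.2 (by simp only [Fintype.card_fin]; omega)
    set mproj : (Fin (p + 1) ↪ Fin n) → E →L[ℂ] (Fin (p + 1) → ℂ) := fun e => coordProj b e
      with hmproj
    have hmsurj : ∀ e, Function.Surjective (mproj e) := fun e => coordProj_surjective b e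
    have hA' : IsAnalyticSetOn 𝓘(ℂ, E) A Ω := fun x hx =>
      Literature.Analysis.Complex.SCV.isZeroSetAt_iff_isAnalyticSetAt.1 (hA x hx)
    have hW' : ∃ W ∈ 𝓝 a, ∀ x ∈ W ∩ regularLocus 𝓘(ℂ, E) A, ∀ q,
        IsRegularPointOfCodim 𝓘(ℂ, E) A q x → Module.finrank ℂ E ≤ q + (p + 1) := by
      obtain ⟨W, hW, h⟩ := hW
      refine ⟨W, hW, fun x hx q hq => ?_⟩
      rw [regularLocus_eq_regLocus] at hx
      exact h x hx q (isRegularPointOfCodim_iff_isRegPt.1 hq)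
    obtain ⟨l, hl⟩ := (exists_continuousLinearEquiv_forall_isCompact_inter_preimage_holds E)
      hmsurj hΩ hAΩ hA' haA hW'
    choose V₁ hV₁o haV₁ V' hV'o hV₁V' hcpt using hl
    set ℓ : (Fin (p + 1) ↪ Fin n) → E →L[ℂ] (Fin (p + 1) → ℂ) :=
      fun e => (coordProj b e).comp (l : E →L[ℂ] E) with hℓ
    have hℓsurj : ∀ e, Function.Surjective (ℓ e) := fun e =>
      (coordProj_surjective b e).comp l.surjective
    have hK : ∀ e, IsCompact (A ∩ V₁ e ∩ ℓ e ⁻¹' {ℓ e a}) := fun e =>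
      hcpt e {ℓ e a} (singleton_subset_iff.2 (hV₁V' e (haV₁ e))) isCompact_singleton
    -- the local analytic covers
    have hcov := fun e => exists_projection_cover hm (hℓsurj e) hΩ hAΩ hA haA (hV₁o e) (haV₁ e)
      (hK e)
    choose P hPo haP hPΩ hKP B hBsub hBan hBreg hBdim using hcov
    choose K hKfib using hKP
    -- uniform transversality
    have htr : ∀ T : Submodule ℂ E, Module.finrank ℂ T = p + 1 →
        ∃ e, LinearMap.ker (ℓ e : E →ₗ[ℂ] (Fin (p + 1) → ℂ)) ⊓ T = ⊥ := by
      intro T hT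
      obtain ⟨e, he⟩ := exists_embedding_ker_coordProj_comp_disjoint b l T hT
      exact ⟨e, by rw [inf_comm]; exact he⟩
    obtain ⟨Ctr, hCtr⟩ := exists_uniform_bound_normed ℓ htr
    -- the neighbourhood
    set U : Set E := (Ω ∩ ball a 1) ∩ ⋂ e, P e with hU
    have hUo : IsOpen U := (hΩ.inter isOpen_ball).inter (isOpen_iInter_of_finite hPo)
    have haU : a ∈ U := ⟨⟨haΩ, mem_ball_self one_pos⟩, mem_iInter.2 haP⟩
    have hUΩ : U ⊆ Ω := fun z hz => hz.1.1
    have hUP : ∀ e, U ⊆ P e := fun e z hz => mem_iInter.1 hz.2 e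
    have hUbdd : Bornology.IsBounded U := isBounded_ball.subset fun z hz => hz.1.2
    refine ⟨U, hUo.mem_nhds haU, ?_⟩
    -- the top-dimensional regular part `R` and the rest
    set R : Set E := {x ∈ A ∩ U | IsRegPt A (m + 1) x} with hR
    have e₀ : Fin (p + 1) ↪ Fin n := Classical.arbitrary _
    have hsplit : A ∩ U ⊆ R ∪ B e₀ := by
      intro z hz
      by_cases hzr : IsRegPt A (m + 1) z
      · exact Or.inl ⟨hz, hzr⟩
      · right
        by_contra hzB
        exact hzr (hBreg e₀ z ⟨hz.1, hUP e₀ hz.2⟩ hzB)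
    haveI : CompleteSpace E := FiniteDimensional.complete ℂ E
    haveI : ProperSpace E := FiniteDimensional.proper_rclike ℂ E
    -- (1) the rest is `μH[2(p+1)]`-null, by the induction hypothesis applied to `B e₀` on `P e₀`
    have hBnull : μH[(2 * (p + 1) : ℕ)] (B e₀) = 0 := by
      have hloc : ∀ x ∈ P e₀, ∃ Ux ∈ 𝓝 x, μH[(2 * (p + 1) : ℕ)] (B e₀ ∩ Ux) = 0 := by
        intro x hx
        obtain ⟨Ux, hUx, hfin⟩ := ih (hPo e₀) ((hBsub e₀).trans inter_subset_right) (hBan e₀) hx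
          ⟨univ, univ_mem, fun y hy q hq => by
            have := hBdim e₀ y hy.2 q hq
            omega⟩
        exact ⟨Ux, hUx, hausdorffMeasure_eq_zero_of_lt_of_lt_top (Nat.cast_lt.2 (by omega)) hfin⟩
      choose! Ux hUx hUx0 using hloc
      obtain ⟨T₀, hT₀c, hT₀P, hT₀cov⟩ :
          ∃ T₀ : Set E, T₀.Countable ∧ T₀ ⊆ P e₀ ∧ P e₀ ⊆ ⋃ x ∈ T₀, Ux x := by
        obtain ⟨T₀, hT₀P, hT₀c, hcov⟩ := TopologicalSpace.countable_cover_nhdsWithin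
          (f := fun x => P e₀ ∩ Ux x) (s := P e₀) fun x hx => inter_mem_nhdsWithin _ (hUx x hx)
        refine ⟨T₀, hT₀c, hT₀P, fun z hz => ?_⟩
        obtain ⟨x, hx, hzx⟩ := mem_iUnion₂.1 (hcov hz)
        exact mem_iUnion₂.2 ⟨x, hx, hzx.2⟩
      have hBcov : B e₀ ⊆ ⋃ x ∈ T₀, B e₀ ∩ Ux x := by
        intro z hz
        have hzP : z ∈ P e₀ := (hBsub e₀ hz).2
        obtain ⟨x, hx, hzx⟩ := mem_iUnion₂.1 (hT₀cov hzP)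
        exact mem_iUnion₂.2 ⟨x, hx, hz, hzx⟩
      refine measure_mono_null hBcov ((measure_biUnion_null_iff hT₀c).2 fun x hx => ?_)
      exact hUx0 x (hT₀P hx)
    -- (2) the top-dimensional regular part: Lipschitz graph pieces of bounded multiplicity
    have hRfin : μH[(2 * (p + 1) : ℕ)] R < ⊤ := by
      obtain ⟨R₀, hR₀c, -, W, k, s, hdata, hcov⟩ :=
        exists_countable_lipschitz_graph_cover ℓ hℓsurj hm hCtr A hUo (q := m + 1)
      rcases R₀.eq_empty_or_nonempty with hR₀ | hR₀ne
      · have hRempty : R = ∅ := by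
          apply eq_empty_of_subset_empty
          intro z hz
          have := hcov hz
          rw [hR₀] at this
          simp at this
        rw [hRempty, measure_empty]; exact ENNReal.zero_lt_top
      obtain ⟨x, hxR₀⟩ := hR₀c.exists_eq_range hR₀ne
      have hxmem : ∀ j, x j ∈ R₀ := fun j => by rw [hxR₀]; exact mem_range_self j
      -- disjoint Borel pieces
      set G : ℕ → Set E := fun j => A ∩ U ∩ W (x j) with hG
      have hGm : ∀ j, MeasurableSet (G j) := fun j => by
        have h1 : MeasurableSet (A ∩ U) := measurableSet_inter_of_isZeroSetAt hA hUo hUΩ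
        exact h1.inter (hdata (x j) (hxmem j)).1.measurableSet
      set D : ℕ → Set E := disjointed G with hD
      have hDm : ∀ j, MeasurableSet (D j) := MeasurableSet.disjointed hGm
      have hDG : ∀ j, D j ⊆ G j := disjointed_subset G
      have hRcov : R ⊆ ⋃ j, D j := by
        rw [hD, iUnion_disjointed]
        intro z hz
        have h1 := hcov ⟨hz.1, hz.2⟩
        rw [hxR₀] at h1
        obtain ⟨_, ⟨j, rfl⟩, hzj⟩ := mem_iUnion₂.1 h1
        exact mem_iUnion.2 ⟨j, hz.1, hzj⟩
      -- grouped by the projection used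
      set Fe : (Fin (p + 1) ↪ Fin n) → ℕ → Set E := fun e j => if k (x j) = e then D j else ∅
        with hFe
      have hFeD : ∀ e j, Fe e j ⊆ D j := fun e j => by
        by_cases h : k (x j) = e
        · simp only [hFe, if_pos h]; exact Subset.rfl
        · simp only [hFe, if_neg h]; exact empty_subset _
      have hDcov : (⋃ j, D j) ⊆ ⋃ e, ⋃ j, Fe e j := by
        intro z hz
        obtain ⟨j, hzj⟩ := mem_iUnion.1 hz
        refine mem_iUnion.2 ⟨k (x j), mem_iUnion.2 ⟨j, ?_⟩⟩
        simp only [hFe, if_pos rfl]; exact hzj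
      have hbound : ∀ e, μH[(2 * (p + 1) : ℕ)] (⋃ j, Fe e j) < ⊤ := by
        intro e
        have hsec : ∀ j, k (x j) = e → ∀ z ∈ D j, s (x j) (ℓ e z) = z := fun j hj z hz => by
          have := (hdata (x j) (hxmem j)).2.2.2.2.1 z ⟨(hDG j hz).1.1, (hDG j hz).2⟩
          rwa [hj] at this
        have hest := hausdorffMeasure_iUnion_le_of_lipschitzOnWith_of_fibre
          (X := E) (Y := Fin (p + 1) → ℂ) (d := ((2 * (p + 1) : ℕ) : ℝ)) (by positivity)
          (L := Ctr + 1) (K := K e) (Fe e) (ℓ e) (fun j => s (x j)) ?_ ?_ ?_ ?_ ?_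
        · refine lt_of_le_of_lt hest (ENNReal.mul_lt_top (ENNReal.mul_lt_top ?_ ?_) ?_)
          · exact ENNReal.rpow_lt_top_of_nonneg (by positivity) ENNReal.coe_ne_top
          · exact ENNReal.natCast_lt_top _
          · refine lt_of_le_of_lt (measure_mono ?_)
              (hausdorffMeasure_pi_complex_lt_top_of_isBounded (p + 1)
                ((ℓ e).lipschitz.isBounded_image hUbdd))
            refine iUnion_subset fun j => image_mono ?_
            exact (hFeD e j).trans ((hDG j).trans fun z hz => hz.1.2)
        · -- pieces are images of their projections under the sections
          intro j z hz
          by_cases hj : k (x j) = e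
          · have hzD : z ∈ D j := by simpa [hFe, hj] using hz
            exact ⟨ℓ e z, mem_image_of_mem _ hz, hsec j hj z hzD⟩
          · simp [hFe, hj] at hz
        · -- Lipschitz sections
          intro j
          by_cases hj : k (x j) = e
          · have hW := (hdata (x j) (hxmem j)).2.2.2.1
            rw [hj] at hW
            refine hW.mono (image_mono ?_)
            exact (hFeD e j).trans ((hDG j).trans fun z hz => hz.2)
          · simp only [hFe, if_neg hj, image_empty]
            exact lipschitzOnWith_empty _ _
        · -- measurable projections (Lusin–Souslin)
          intro j
          by_cases hj : k (x j) = e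
          · simp only [hFe, if_pos hj]
            refine (hDm j).image_of_continuousOn_injOn (ℓ e).continuous.continuousOn ?_
            intro z hz z' hz' hzz'
            rw [← hsec j hj z hz, ← hsec j hj z' hz', hzz']
          · simp only [hFe, if_neg hj, image_empty]; exact MeasurableSet.empty
        · -- pairwise disjoint
          intro i j hij
          exact (disjoint_disjointed G hij).mono (hFeD e i) (hFeD e j)
        · -- bounded fibres
          intro y S hS₁ hS₂
          refine hKfib e y S (fun z hz => ?_) hS₂
          obtain ⟨j, hzj⟩ := mem_iUnion.1 (hS₁ hz)
          have hzG := hDG j (hFeD e j hzj)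
          exact ⟨hzG.1.1, hUP e hzG.1.2⟩
      calc μH[(2 * (p + 1) : ℕ)] R ≤ μH[(2 * (p + 1) : ℕ)] (⋃ e, ⋃ j, Fe e j) :=
            measure_mono (hRcov.trans hDcov)
        _ ≤ ∑' e, μH[(2 * (p + 1) : ℕ)] (⋃ j, Fe e j) := measure_iUnion_le _
        _ = ∑ e, μH[(2 * (p + 1) : ℕ)] (⋃ j, Fe e j) := tsum_fintype _
        _ < ⊤ := ENNReal.sum_lt_top.2 fun e _ => hbound e
    -- (3) assembly
    calc μH[(2 * (p + 1) : ℕ)] (A ∩ U) ≤ μH[(2 * (p + 1) : ℕ)] (R ∪ B e₀) := measure_mono hsplit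
      _ ≤ μH[(2 * (p + 1) : ℕ)] R + μH[(2 * (p + 1) : ℕ)] (B e₀) := measure_union_le _ _
      _ < ⊤ := by rw [hBnull, add_zero]; exact hRfin

end Main

end SCV
end Literature.Geometry.Kaehler
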